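import Literature.Topology.FourManifolds.ClosedModelCollarCone
import Literature.Topology.FourManifolds.InteriorConnected
import Literature.AlgebraicTopology.SingularHomology.BoundaryClassGenerator
import Literature.AlgebraicTopology.SingularHomology.FundamentalClassExistence
import Literature.AlgebraicTopology.SingularHomology.NoncompactManifoldProofs
import Literature.AlgebraicTopology.SingularHomology.ExcisionTheorem
import HarnessLib

/-!
# The closed model `W ∪ cone(∂W)` of an oriented null-cobordism is homologically oriented

Kervaire–Milnor, *Groups of homotopy spheres I*, Ann. of Math. 77 (1963), footnote pp. 528–529:
for `W` bounded by a homology sphere "attach a cone over the boundary, thus obtaining a closed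
homology manifold"; its orientation is the one of `W`. In the tree the relation "`μ'` is the
orientation of `W`" between a homological orientation `μ'` of the closed model
`Ŵ = Literature.Topology.FourManifolds.ClosedModel n W` and the relative fundamental class
`[W, ∂W]` is clause (ii) of `Literature.Topology.FourManifolds.IsOrientedBoundary`
(`BoundarySignature.lean`): `q⁎ [W, ∂W] = j⁎ [Ŵ]_{μ'}` in `Hₙ₊₁(Ŵ, ∞)` (Hatcher 2002, Prop. 2.22:
`q : (W, ∂W) → (W/∂W, pt)` induces `Hₙ₊₁(W, ∂W) ≅ Hₙ₊₁(W/∂W, pt)`).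

For a null-cobordism `c₀ : NullCobordism (m + 1) M` with `M : Type` closed, nonempty and
**connected**, `W = c₀.W` **connected**, and a relative fundamental class `z ∈ Hₘ₊₂(W, ∂W; ℤ)`
(`IsRelFundamentalClass`), this file PROVES
(`NullCobordism.exists_orientation_closedModel_of_isRelFundamentalClass`): there is a homological
`ℤ`-orientation `μ'` of `Ŵ` with `q⁎ z = j⁎ [Ŵ]_{μ'}`.

## Proof

Let `ĉ ∈ Hₘ₊₂(Ŵ)` be the absolute class with `j⁎ ĉ = q⁎ z` (`j⁎ : Hₘ₊₂(Ŵ) ≅ Hₘ₊₂(Ŵ, ∞)`,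
exact sequence of the pair; `capClass`). Set `μ'ₓ := ĉ|ₓ ∈ Hₘ₊₂(Ŵ | x)`; local (indeed global)
consistency is automatic, and it remains to see that `ĉ|ₓ` generates `Hₘ₊₂(Ŵ | x) ≅ ℤ`:

* at an interior point `x = ↑v`: `ĉ|ₓ = q⁎ (z|ᵥ)` and `q⁎ : H(W | v) ≅ H(Ŵ | x)` (local homology
  is local: `W ∖ ∂W` is open in `W` and in `Ŵ`), while `z|ᵥ` generates (`hz`);
* at the cone point `∞` (**Mayer–Vietoris at the cone point**): with the open cover
  `Ŵ = (Ŵ ∖ ∞) ∪ Û`, `Û = q(κ(M × [0,1)))` the cone neighbourhood of `∞` (`ClosedModelCollarCone.lean`),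
  `A = Û ∖ ∞ ≅ κ(M × (0, 1))`, the class `j_A ĉ ∈ Hₘ₊₂(Ŵ, A)` is the sum `a + b` of a class `a`
  coming from `(W ∖ ∂W, κ(M × (0,1)))` (excision of `∂W` from `(W, κ(M × [0,1)))`, which carries `z`)
  and a class `b` coming from `(Û, A)` (excision, carrying `ĉ|_∞`) — checked by restricting to
  `(Ŵ, Ŵ ∖ ∞)` and `(Ŵ, Û)`, where `Hₘ₊₂(Ŵ, A) → Hₘ₊₂(Ŵ, Ŵ ∖ ∞) ⊕ Hₘ₊₂(Ŵ, Û)` is injective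
  (exact sequence of the triple and excision, `relativeSingularHomology.eq_zero_of_map_eq_zero_of_cover`);
  applying `∂ : Hₘ₊₂(Ŵ, A) → Hₘ₊₁(A)` gives `∂ b = -∂ a`, and `∂ a` is the boundary class
  `∂ z = ±[∂W]` transported along the homology isomorphisms `∂W ≃ κ(M × [0,1)) ≃ κ(M × (0,1)) ≅ A`
  (`isIso_map_inclusion_boundary_below`, `isIso_map_stripIncl`), a generator since `∂W ≅ M` is a
  closed connected oriented manifold (`boundaryOrientation`, Hatcher Thm. 3.26); as `Û` is
  contractible, `∂ : Hₘ₊₂(Û, A) ≅ Hₘ₊₁(A)`, so `b`, hence `ĉ|_∞`, generates;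
* `[Ŵ]_{μ'} = ĉ` (**uniqueness**): a second fundamental class differs from `ĉ` by a class vanishing
  in `Hₘ₊₂(Ŵ | ∞) = Hₘ₊₂(Ŵ, Ŵ ∖ ∞)`, hence coming from `Hₘ₊₂(Ŵ ∖ ∞) = Hₘ₊₂(W ∖ ∂W) = 0`
  (Hatcher Prop. 3.29: `W ∖ ∂W` is a connected non-compact `(m+2)`-manifold,
  `isZero_singularHomology_of_noncompactSpace_holds`).

Everything is proved; no named facts. Definitions (with bodies): `capClass`,
`HomologicalOrientation.ofGeneratingClass`, `coneOrientation`.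

## Relation to `ClosedModelOrientation.lean`

The sibling tree file `ClosedModelOrientation.lean` orients the closed model under the additional
hypothesis `[ChartedSpace (EuclideanSpace ℝ (Fin (n + 1))) (ClosedModel n W)]` — that `Ŵ` is a
topological manifold, available for `∂W ≅ 𝕊ⁿ` (`NullCobordism.chartedSpaceClosedModel`) and, for
`∂W` a homotopy sphere of dimension `≥ 5`, only through the named fact
`HomotopySphere.nonempty_chartedSpace_closedModel` (generalised Poincaré conjecture) — by
propagating non-vanishing of `ẑ` along the manifold `Ŵ`. Here **no manifold structure on `Ŵ` is
assumed**: the local homology at the cone point is computed directly (Mayer–Vietoris with the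
contractible cone neighbourhood of `ClosedModelCollarCone.lean`), which is what the homology
manifold `W ∪ cone(bW)` of Kervaire–Milnor's footnote requires, for every closed connected `∂W`.
This is the input of the unconditional discharge of
`HomotopySphere.nonempty_signatureSet_of_boundsParallelizable` (`HomotopySpheresSignatureProofs.lean`).

## References

* M. Kervaire, J. Milnor, *Groups of homotopy spheres I*, Ann. of Math. 77 (1963), §7, footnote
  pp. 528–529. [KervaireMilnorAnnals1963]
* A. Hatcher, *Algebraic Topology*, CUP 2002, Prop. 2.22, §2.2 (Mayer–Vietoris), §3.3 Thm. 3.26,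
  Lemma 3.27, Prop. 3.29, p. 253. [HatcherAT2002]
-/

noncomputable section

open scoped Manifold ContDiff Topology ContinuousMap unitInterval
open Set Function CategoryTheory CategoryTheory.Limits Topology
open Literature.AlgebraicTopology.SingularHomology Literature.AlgebraicTopology.Homotopy

/-! ### Generalities -/

namespace Literature.AlgebraicTopology.SingularHomology

universe u v

variable (R : Type v) [CommRing R] (M' : Type v) [AddCommGroup M'] [Module R M']

/-- An element of a zero object of `ModuleCat` is zero. [folklore] -/
lemma eq_zero_of_isZero' {V : ModuleCat.{v} R} (h : IsZero V) (a : V) : a = 0 := by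
  have h1 : (𝟙 V : V ⟶ V) = 0 := h.eq_of_src _ _
  have h2 : (𝟙 V : V ⟶ V) a = (0 : V ⟶ V) a := by rw [h1]
  rw [ModuleCat.id_apply] at h2
  rw [h2]
  rfl

namespace relativeSingularHomology

variable {X : Type u} [TopologicalSpace X]

/-- **Relative Mayer–Vietoris, injectivity**: for an open cover `X = int P ∪ int Q`, a class of
`Hₖ(X, Q ∩ P)` which vanishes in `Hₖ(X, P)` and in `Hₖ(X, Q)` is zero (exact sequence of the
triple `(X, P, Q ∩ P)` and excision `Hₖ(P, Q ∩ P) ≅ Hₖ(X, Q)`; Hatcher 2002, §2.2 p. 152 and the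
proof of Lemma 3.27, step (1)). [cite: HatcherAT2002, §2.2 p. 152 and Lemma 3.27, proof, step (1)] -/
theorem eq_zero_of_map_eq_zero_of_cover {P Q : Set X} (hcov : interior P ∪ interior Q = univ)
    (k : ℕ) (ξ : relativeSingularHomology R M' X (Q ∩ P) k)
    (hP : map R M' (ContinuousMap.id X) (mapsTo_id_of_subset (inter_subset_right : Q ∩ P ⊆ P)) k ξ = 0)
    (hQ : map R M' (ContinuousMap.id X) (mapsTo_id_of_subset (inter_subset_left : Q ∩ P ⊆ Q)) k ξ = 0) :
    ξ = 0 := by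
  -- `ξ` comes from `Hₖ(P, Q ∩ P)`
  obtain ⟨η, rfl⟩ := (ShortComplex.moduleCat_exact_iff _).1
    (triple_exact₂ R M' (inter_subset_right : Q ∩ P ⊆ P) k) ξ hP
  -- and `Hₖ(P, Q ∩ P) → Hₖ(X, Q ∩ P) → Hₖ(X, Q)` is the excision isomorphism
  have heq : (Subtype.val ⁻¹' (Q ∩ P) : Set ↥P) = Subtype.val ⁻¹' Q := by
    ext u
    exact ⟨fun h => h.1, fun h => ⟨h, u.2⟩⟩
  have hid : MapsTo (ContinuousMap.id ↥P) (Subtype.val ⁻¹' (Q ∩ P) : Set ↥P) (Subtype.val ⁻¹' Q) :=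
    fun u hu => hu.1
  haveI := isIso_map_id_of_eq R M' heq hid k
  haveI := isIso_map_of_interior_union_interior_holds R M' X Q P (by rwa [union_comm]) k
  have hfac : map R M' (⟨Subtype.val, continuous_subtype_val⟩ : C(↥P, X)) (mapsTo_val_preimage P (Q ∩ P)) k ≫
      map R M' (ContinuousMap.id X) (mapsTo_id_of_subset (inter_subset_left : Q ∩ P ⊆ Q)) k =
        map R M' (ContinuousMap.id ↥P) hid k ≫ map R M' (subsetIncl P) (mapsTo_preimage Subtype.val Q) k := by
    rw [← map_comp, ← map_comp]
    rfl
  have hη : (map R M' (ContinuousMap.id ↥P) hid k ≫ map R M' (subsetIncl P) (mapsTo_preimage Subtype.val Q) k) η = 0 := by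
    rw [← hfac, ModuleCat.comp_apply]
    exact hQ
  have hη0 : η = 0 := by
    have hinj : Function.Injective
        (map R M' (ContinuousMap.id ↥P) hid k ≫ map R M' (subsetIncl P) (mapsTo_preimage Subtype.val Q) k) :=
      (ModuleCat.mono_iff_injective _).1 inferInstance
    apply hinj
    rw [hη, map_zero]
  rw [hη0, map_zero]

/-- **`j⁎ : Hₖ₊₂(X) ≅ Hₖ₊₂(X, x₀)`** for a point `x₀` (exact sequence of the pair; `Hᵢ(pt) = 0`
for `i ≥ 1`; Hatcher 2002, Ex. 2.18 / Prop. 2.22). [cite: HatcherAT2002, §2.1, Thm. 2.13 ff.] -/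
theorem isIso_ofAbsolute_singleton (x₀ : X) (k : ℕ) : IsIso (ofAbsolute R M' X {x₀} (k + 1 + 1)) := by
  have h1 : IsZero (singularHomology R M' ↥({x₀} : Set X) (k + 1 + 1)) :=
    isZero_singularHomology_of_subsingleton R M' (by omega)
  have h0 : IsZero (singularHomology R M' ↥({x₀} : Set X) (k + 1)) :=
    isZero_singularHomology_of_subsingleton R M' (by omega)
  have hm : Mono (ofAbsolute R M' X {x₀} (k + 1 + 1)) :=
    (exact_map_ofAbsolute R M' ({x₀} : Set X) (k + 1 + 1)).mono_g (h1.eq_of_src _ _)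
  have he : Epi (ofAbsolute R M' X {x₀} (k + 1 + 1)) :=
    (exact_ofAbsolute_δ R M' ({x₀} : Set X) (k + 1)).epi_f (h0.eq_of_tgt _ _)
  exact isIso_of_mono_of_epi _

/-- Naturality of the connecting homomorphism, applied to an element: for a map of pairs
`f : (X, A) → (Y, B)`, `∂ (f⁎ x) = (f|_A)⁎ (∂ x)` (Hatcher 2002, §2.1). [cite: HatcherAT2002, §2.1 (naturality, after Thm. 2.16)] -/
theorem δ_map_apply {Y : Type u} [TopologicalSpace Y] {A : Set X} {B : Set Y} (f : C(X, Y))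
    (h : MapsTo f A B) (n : ℕ) (x : relativeSingularHomology R M' X A (n + 1)) :
    δ R M' Y B n (map R M' f h (n + 1) x) = singularHomology.map R M' (subsetRestrict f h) n (δ R M' X A n x) := by
  rw [← ModuleCat.comp_apply, ← δ_naturality, ModuleCat.comp_apply]

end relativeSingularHomology

namespace HomologicalOrientation

variable {R}
variable {X : Type u} [TopologicalSpace X] {n : ℕ}

/-- **The orientation defined by a global class generating every local homology group**: if
`c ∈ Hₙ(X; R)` restricts to a generator of `Hₙ(X | x; R)` at every point, then `x ↦ c|ₓ` is an
`R`-orientation (globally consistent, represented on `X` by `c`), and `c` is a fundamental class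
for it. (Hatcher 2002, Thm. 3.26: the fundamental class determines the orientation.) [cite: HatcherAT2002, §3.3 Thm. 3.26] -/
def ofGeneratingClass (c : singularHomology R R X n)
    (hc : ∀ x : X, ∃ e : localHomology R R X x n ≃ₗ[R] R, e (singularHomology.toLocal R R x n c) = 1) :
    HomologicalOrientation R X n where
  localClass x := singularHomology.toLocal R R x n c
  isGenerator := hc
  locallyConsistent _ := ⟨univ, Filter.univ_mem, singularHomology.toLocalOfSet R R X univ n c,
    fun _ hy => singularHomology.restrictToPoint_toLocalOfSet R R hy n c⟩

/-- The local classes of `ofGeneratingClass c` are the `c|ₓ`. [folklore] -/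
@[simp] theorem ofGeneratingClass_localClass (c : singularHomology R R X n)
    (hc : ∀ x : X, ∃ e : localHomology R R X x n ≃ₗ[R] R, e (singularHomology.toLocal R R x n c) = 1)
    (x : X) : (ofGeneratingClass c hc).localClass x = singularHomology.toLocal R R x n c := rfl

/-- `c` is a fundamental class of `ofGeneratingClass c`. [folklore] -/
theorem isFundamentalClass_ofGeneratingClass (c : singularHomology R R X n)
    (hc : ∀ x : X, ∃ e : localHomology R R X x n ≃ₗ[R] R, e (singularHomology.toLocal R R x n c) = 1) :
    IsFundamentalClass (ofGeneratingClass c hc) c := fun _ => rfl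

end HomologicalOrientation

end Literature.AlgebraicTopology.SingularHomology

/-! ### The orientation of the closed model -/

namespace Literature.Topology.FourManifolds

/-- Local notation: `𝔼 n` is the model Euclidean space `EuclideanSpace ℝ (Fin n)`. -/
local notation "𝔼 " n:arg => EuclideanSpace ℝ (Fin n)

namespace NullCobordism

variable {m : ℕ} {M : Type} [TopologicalSpace M] [ChartedSpace (𝔼 (m + 1)) M]
  [IsManifold (𝓡 (m + 1)) ∞ M] [CompactSpace M] (c₀ : NullCobordism (m + 1) M)

/-! #### The absolute class `ĉ` with `j⁎ ĉ = q⁎ z` -/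

omit [IsManifold (𝓡 (m + 1)) ∞ M] [CompactSpace M] in
/-- `j⁎ : Hₘ₊₂(Ŵ) ≅ Hₘ₊₂(Ŵ, ∞)`. [cite: HatcherAT2002, Prop. 2.22] -/
theorem isIso_ofAbsolute_infty :
    IsIso (relativeSingularHomology.ofAbsolute ℤ ℤ (ClosedModel (m + 1) c₀.W) {ClosedModel.infty} (m + 1 + 1)) :=
  relativeSingularHomology.isIso_ofAbsolute_singleton ℤ ℤ _ m

/-- **The absolute class `ĉ ∈ Hₘ₊₂(Ŵ; ℤ)` with `j⁎ ĉ = q⁎ z`** for a relative class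
`z ∈ Hₘ₊₂(W, ∂W; ℤ)` (the class of the closed model corresponding to `[W, ∂W]` under
`Hₘ₊₂(W, ∂W) → Hₘ₊₂(Ŵ, ∞) ≅ Hₘ₊₂(Ŵ)`, Hatcher 2002, Prop. 2.22). [cite: HatcherAT2002, Prop. 2.22] -/
def capClass (z : relativeSingularHomology ℤ ℤ c₀.W ((𝓡∂ (m + 1 + 1)).boundary c₀.W) (m + 1 + 1)) :
    singularHomology ℤ ℤ (ClosedModel (m + 1) c₀.W) (m + 1 + 1) :=
  haveI := c₀.isIso_ofAbsolute_infty
  inv (relativeSingularHomology.ofAbsolute ℤ ℤ (ClosedModel (m + 1) c₀.W) {ClosedModel.infty} (m + 1 + 1))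
    (relativeSingularHomology.map ℤ ℤ (boundaryCollapse (m + 1) c₀.W) (mapsTo_boundaryCollapse (m + 1) c₀.W)
      (m + 1 + 1) z)

omit [IsManifold (𝓡 (m + 1)) ∞ M] [CompactSpace M] in
/-- Defining property of `ĉ`: `j⁎ ĉ = q⁎ z`. [cite: HatcherAT2002, Prop. 2.22] -/
theorem ofAbsolute_capClass (z : relativeSingularHomology ℤ ℤ c₀.W ((𝓡∂ (m + 1 + 1)).boundary c₀.W) (m + 1 + 1)) :
    relativeSingularHomology.ofAbsolute ℤ ℤ (ClosedModel (m + 1) c₀.W) {ClosedModel.infty} (m + 1 + 1) (c₀.capClass z) =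
      relativeSingularHomology.map ℤ ℤ (boundaryCollapse (m + 1) c₀.W) (mapsTo_boundaryCollapse (m + 1) c₀.W)
        (m + 1 + 1) z := by
  haveI := c₀.isIso_ofAbsolute_infty
  rw [capClass, ← ModuleCat.comp_apply, IsIso.inv_hom_id, ModuleCat.id_apply]

omit [IsManifold (𝓡 (m + 1)) ∞ M] [CompactSpace M] in
/-- `ĉ` pushed to `Hₘ₊₂(Ŵ, S)` for any `S ∋ ∞` is `q⁎ z` read in `(Ŵ, S)`. [folklore] -/
theorem ofAbsolute_capClass_of_mem (z : relativeSingularHomology ℤ ℤ c₀.W ((𝓡∂ (m + 1 + 1)).boundary c₀.W) (m + 1 + 1))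
    {S : Set (ClosedModel (m + 1) c₀.W)} (hS : ClosedModel.infty ∈ S) :
    relativeSingularHomology.ofAbsolute ℤ ℤ (ClosedModel (m + 1) c₀.W) S (m + 1 + 1) (c₀.capClass z) =
      relativeSingularHomology.map ℤ ℤ (boundaryCollapse (m + 1) c₀.W)
        ((mapsTo_boundaryCollapse (m + 1) c₀.W).mono_right (singleton_subset_iff.2 hS)) (m + 1 + 1) z := by
  have h1 : relativeSingularHomology.ofAbsolute ℤ ℤ (ClosedModel (m + 1) c₀.W) S (m + 1 + 1) =
      relativeSingularHomology.ofAbsolute ℤ ℤ (ClosedModel (m + 1) c₀.W) {ClosedModel.infty} (m + 1 + 1) ≫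
        relativeSingularHomology.map ℤ ℤ (ContinuousMap.id _) (mapsTo_id_of_subset (singleton_subset_iff.2 hS)) (m + 1 + 1) := by
    rw [relativeSingularHomology.ofAbsolute_comp_map, singularHomology.map_id, Category.id_comp]
  rw [h1, ModuleCat.comp_apply, ofAbsolute_capClass, ← ModuleCat.comp_apply,
    ← relativeSingularHomology.map_comp]
  rfl

/-! #### Generators at interior points -/

omit [IsManifold (𝓡 (m + 1)) ∞ M] [CompactSpace M] in
/-- The collapse is a map of pairs `(W, W ∖ v) → (Ŵ, Ŵ ∖ ↑v)` at an interior point `v`. [folklore] -/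
theorem mapsTo_boundaryCollapse_compl_singleton_coe (v : ManifoldInterior (m + 1) c₀.W) :
    MapsTo (boundaryCollapse (m + 1) c₀.W) ({v.1}ᶜ : Set c₀.W)
      ({ClosedModel.ofInterior v}ᶜ : Set (ClosedModel (m + 1) c₀.W)) :=
  fun _ hw h => hw (c₀.eq_of_boundaryCollapse_eq_coe h)

omit [IsManifold (𝓡 (m + 1)) ∞ M] [CompactSpace M] in
/-- The open embedding of the interior is a map of pairs at every point. [folklore] -/
theorem mapsTo_coeCM_compl_singleton (v : ManifoldInterior (m + 1) c₀.W) :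
    MapsTo (c₀.coeCM : ManifoldInterior (m + 1) c₀.W → ClosedModel (m + 1) c₀.W) ({v}ᶜ : Set _)
      ({ClosedModel.ofInterior v}ᶜ : Set (ClosedModel (m + 1) c₀.W)) :=
  fun _ hw h => hw (OnePoint.coe_injective h)

omit [IsManifold (𝓡 (m + 1)) ∞ M] [CompactSpace M] in
/-- The inclusion of the interior is a map of pairs at every point. [folklore] -/
theorem mapsTo_valICM_compl_singleton (v : ManifoldInterior (m + 1) c₀.W) :
    MapsTo (c₀.valICM : ManifoldInterior (m + 1) c₀.W → c₀.W) ({v}ᶜ : Set _) ({v.1}ᶜ : Set c₀.W) :=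
  fun _ hw h => hw (Subtype.ext h)

omit [IsManifold (𝓡 (m + 1)) ∞ M] [CompactSpace M] in
/-- **`q⁎ : Hₖ(W | v) ≅ Hₖ(Ŵ | ↑v)` at an interior point** (local homology is local: both
`W ∖ ∂W ↪ W` and `W ∖ ∂W ↪ Ŵ` are open embeddings and `q ∘ val = coe`). [cite: HatcherAT2002, §3.3 p. 231] -/
theorem isIso_map_boundaryCollapse_local (v : ManifoldInterior (m + 1) c₀.W) (k : ℕ) :
    IsIso (relativeSingularHomology.map ℤ ℤ (boundaryCollapse (m + 1) c₀.W)
      (c₀.mapsTo_boundaryCollapse_compl_singleton_coe v) k) := by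
  haveI h1 : IsIso (relativeSingularHomology.map ℤ ℤ c₀.valICM (c₀.mapsTo_valICM_compl_singleton v) k) :=
    localHomology.isIso_map_of_isOpenEmbedding ℤ ℤ c₀.valICM
      (((𝓡∂ (m + 1 + 1)).isOpen_interior (M := c₀.W) one_ne_zero).isOpenEmbedding_subtypeVal) v _ k
  haveI h2 : IsIso (relativeSingularHomology.map ℤ ℤ c₀.coeCM (c₀.mapsTo_coeCM_compl_singleton v) k) :=
    localHomology.isIso_map_of_isOpenEmbedding ℤ ℤ c₀.coeCM OnePoint.isOpenEmbedding_coe v _ k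
  have hfac : relativeSingularHomology.map ℤ ℤ c₀.valICM (c₀.mapsTo_valICM_compl_singleton v) k ≫
      relativeSingularHomology.map ℤ ℤ (boundaryCollapse (m + 1) c₀.W)
        (c₀.mapsTo_boundaryCollapse_compl_singleton_coe v) k =
      relativeSingularHomology.map ℤ ℤ c₀.coeCM (c₀.mapsTo_coeCM_compl_singleton v) k := by
    rw [← relativeSingularHomology.map_comp]
    exact relativeSingularHomology.map_congr ℤ ℤ c₀.boundaryCollapse_comp_valICM _ _ k
  haveI : IsIso (relativeSingularHomology.map ℤ ℤ c₀.valICM (c₀.mapsTo_valICM_compl_singleton v) k ≫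
      relativeSingularHomology.map ℤ ℤ (boundaryCollapse (m + 1) c₀.W)
        (c₀.mapsTo_boundaryCollapse_compl_singleton_coe v) k) := by
    rw [hfac]; exact h2
  exact IsIso.of_isIso_comp_left
    (relativeSingularHomology.map ℤ ℤ c₀.valICM (c₀.mapsTo_valICM_compl_singleton v) k) _

omit [IsManifold (𝓡 (m + 1)) ∞ M] [CompactSpace M] in
/-- **`ĉ|ₓ` generates `Hₘ₊₂(Ŵ | x)` at an interior point `x = ↑v`**: `ĉ|ₓ = q⁎ (z|ᵥ)`, `q⁎` is an
isomorphism of local homology at interior points and `z|ᵥ` generates. [cite: HatcherAT2002, §3.3 p. 253] -/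
theorem isGenerator_toLocal_capClass_coe
    {z : relativeSingularHomology ℤ ℤ c₀.W ((𝓡∂ (m + 1 + 1)).boundary c₀.W) (m + 1 + 1)}
    (hz : IsRelFundamentalClass ℤ ((𝓡∂ (m + 1 + 1)).boundary c₀.W) z)
    (v : ManifoldInterior (m + 1) c₀.W) :
    ∃ e : localHomology ℤ ℤ (ClosedModel (m + 1) c₀.W) (ClosedModel.ofInterior v) (m + 1 + 1) ≃ₗ[ℤ] ℤ,
      e (singularHomology.toLocal ℤ ℤ (ClosedModel.ofInterior v) (m + 1 + 1) (c₀.capClass z)) = 1 := by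
  have hvB : v.1 ∈ (((𝓡∂ (m + 1 + 1)).boundary c₀.W)ᶜ : Set c₀.W) := by
    rw [ModelWithCorners.compl_boundary]; exact v.2
  have key : singularHomology.toLocal ℤ ℤ (ClosedModel.ofInterior v) (m + 1 + 1) (c₀.capClass z) =
      relativeSingularHomology.map ℤ ℤ (boundaryCollapse (m + 1) c₀.W)
        (c₀.mapsTo_boundaryCollapse_compl_singleton_coe v) (m + 1 + 1)
        (relativeSingularHomology.toLocal ℤ ℤ ((𝓡∂ (m + 1 + 1)).boundary c₀.W) ⟨v.1, hvB⟩ (m + 1 + 1) z) := by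
    have hS : ClosedModel.infty ∈ ({ClosedModel.ofInterior v}ᶜ : Set (ClosedModel (m + 1) c₀.W)) :=
      OnePoint.infty_ne_coe v
    change relativeSingularHomology.ofAbsolute ℤ ℤ _ {ClosedModel.ofInterior v}ᶜ (m + 1 + 1) (c₀.capClass z) = _
    rw [c₀.ofAbsolute_capClass_of_mem z hS, relativeSingularHomology.toLocal, ← ModuleCat.comp_apply,
      ← relativeSingularHomology.map_comp]
    rfl
  rw [key]
  haveI := c₀.isIso_map_boundaryCollapse_local v (m + 1 + 1)
  exact (exists_linearEquiv_apply_eq_one_iff_of_isIso _ _).2 (hz ⟨v.1, hvB⟩)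

/-! #### The generator at the cone point -/

section ConePoint

variable {κ : BoundaryCollar c₀.W M}

/-- The punctured closed model `Ŵ ∖ ∞`. [folklore] -/
abbrev punct : Set (ClosedModel (m + 1) c₀.W) := {ClosedModel.infty}ᶜ

/-- The punctured cone neighbourhood `A = Û ∖ ∞`, realised as `Û ∩ (Ŵ ∖ ∞)`. [folklore] -/
abbrev punctCone (κ : BoundaryCollar c₀.W M) : Set (ClosedModel (m + 1) c₀.W) := c₀.collarConeNhd κ ∩ c₀.punct

omit [IsManifold (𝓡 (m + 1)) ∞ M] [CompactSpace M] in
/-- The open embedding of the interior maps the strip into the punctured cone neighbourhood. [folklore] -/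
theorem mapsTo_coeCM_strip_punctCone (hκ : ∀ x : M, κ.collar (x, 0) = c₀.incl x) :
    MapsTo (c₀.coeCM : ManifoldInterior (m + 1) c₀.W → ClosedModel (m + 1) c₀.W)
      (c₀.stripInterior κ) (c₀.punctCone κ) :=
  fun v hv => ⟨(c₀.coe_mem_collarConeNhd_iff hκ v).2 hv, OnePoint.coe_ne_infty v⟩

omit [IsManifold (𝓡 (m + 1)) ∞ M] [CompactSpace M] in
/-- The strip of the interior is the preimage of the punctured cone neighbourhood. [folklore] -/
theorem stripInterior_eq_preimage_punctCone (hκ : ∀ x : M, κ.collar (x, 0) = c₀.incl x) :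
    c₀.stripInterior κ = (c₀.coeCM : ManifoldInterior (m + 1) c₀.W → ClosedModel (m + 1) c₀.W) ⁻¹' c₀.punctCone κ := by
  ext v
  exact ⟨fun hv => c₀.mapsTo_coeCM_strip_punctCone hκ hv, fun hv => (c₀.coe_mem_collarConeNhd_iff hκ v).1 hv.1⟩

omit [IsManifold (𝓡 (m + 1)) ∞ M] [CompactSpace M] in
/-- `Û ↪ Ŵ` maps the punctured part into the punctured cone neighbourhood. [folklore] -/
theorem mapsTo_val_punct_punctCone :
    MapsTo (Subtype.val : ↥(c₀.collarConeNhd κ) → ClosedModel (m + 1) c₀.W)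
      (Subtype.val ⁻¹' c₀.punct : Set ↥(c₀.collarConeNhd κ)) (c₀.punctCone κ) :=
  fun u hu => ⟨u.2, hu⟩

omit [IsManifold (𝓡 (m + 1)) ∞ M] [CompactSpace M] in
/-- The collapse maps the open collar into the cone neighbourhood. [folklore] -/
theorem mapsTo_boundaryCollapse_below_collarConeNhd (hκ : ∀ x : M, κ.collar (x, 0) = c₀.incl x) :
    MapsTo (boundaryCollapse (m + 1) c₀.W) (κ.below 1) (c₀.collarConeNhd κ) :=
  fun _ hw => (c₀.boundaryCollapse_mem_collarConeNhd_iff hκ).2 hw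

omit [IsManifold (𝓡 (m + 1)) ∞ M] [CompactSpace M] in
/-- **The excision at the cone point**: `Hₖ(Û, Û ∖ ∞) ≅ Hₖ(Ŵ, Ŵ ∖ ∞) = Hₖ(Ŵ | ∞)`. [cite: HatcherAT2002, Thm. 2.20] -/
theorem isIso_map_collarConeNhd_punct (hκ : ∀ x : M, κ.collar (x, 0) = c₀.incl x) (k : ℕ) :
    IsIso (relativeSingularHomology.map ℤ ℤ (subsetIncl (c₀.collarConeNhd κ))
      (mapsTo_preimage Subtype.val c₀.punct) k) :=
  relativeSingularHomology.isIso_map_of_interior_union_interior_holds ℤ ℤ _ c₀.punct (c₀.collarConeNhd κ)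
    (c₀.interior_compl_infty_union_interior_collarConeNhd hκ) k

omit [IsManifold (𝓡 (m + 1)) ∞ M] [CompactSpace M] in
/-- **The excision of the boundary**: `Hₖ(W ∖ ∂W, κ(M × (0,1))) ≅ Hₖ(W, κ(M × [0,1)))`. [cite: HatcherAT2002, Thm. 2.20, with §3.3 p. 253] -/
theorem isIso_map_valICM_strip (hκ : ∀ x : M, κ.collar (x, 0) = c₀.incl x) (k : ℕ) :
    IsIso (relativeSingularHomology.map ℤ ℤ c₀.valICM (c₀.mapsTo_val_stripInterior κ) k) := by
  have hcov : interior (κ.below 1) ∪ interior ((𝓡∂ (m + 1 + 1)).interior c₀.W) = univ := by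
    rw [(κ.isOpen_below 1).interior_eq, ((𝓡∂ (m + 1 + 1)).isOpen_interior (M := c₀.W) one_ne_zero).interior_eq]
    refine eq_univ_of_forall fun w => ?_
    by_cases hw : w ∈ (𝓡∂ (m + 1 + 1)).boundary c₀.W
    · exact Or.inl (c₀.boundary_subset_below hκ zero_lt_one hw)
    · exact Or.inr (by rw [← ModelWithCorners.compl_boundary]; exact hw)
  exact relativeSingularHomology.isIso_map_of_interior_union_interior_holds ℤ ℤ c₀.W (κ.below 1)
    ((𝓡∂ (m + 1 + 1)).interior c₀.W) hcov k

omit [IsManifold (𝓡 (m + 1)) ∞ M] [CompactSpace M] in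
/-- **`Hₘ₊₁` of the strip maps isomorphically onto `Hₘ₊₁` of the punctured cone neighbourhood** along
the open embedding `coe` (a homeomorphism between them). [folklore] -/
theorem isIso_map_subsetRestrict_coeCM (hκ : ∀ x : M, κ.collar (x, 0) = c₀.incl x) (k : ℕ) :
    IsIso (singularHomology.map ℤ ℤ (subsetRestrict c₀.coeCM (c₀.mapsTo_coeCM_strip_punctCone hκ)) k) := by
  have hemb : IsEmbedding (c₀.coeCM : ManifoldInterior (m + 1) c₀.W → ClosedModel (m + 1) c₀.W) :=
    OnePoint.isOpenEmbedding_coe.toIsEmbedding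
  have hsub : c₀.punctCone κ ⊆ range (c₀.coeCM : ManifoldInterior (m + 1) c₀.W → ClosedModel (m + 1) c₀.W) := by
    intro y hy
    obtain ⟨v, hv⟩ := OnePoint.ne_infty_iff_exists.1 hy.2
    exact ⟨v, hv⟩
  let e : ↥(c₀.stripInterior κ) ≃ₜ ↥(c₀.punctCone κ) :=
    (Homeomorph.setCongr (c₀.stripInterior_eq_preimage_punctCone hκ)).trans (hemb.homeomorphOfSubsetRange hsub)
  exact singularHomology.isIso_map_of_homeomorph ℤ ℤ e _ (fun v => Subtype.ext rfl) k

omit [IsManifold (𝓡 (m + 1)) ∞ M] [CompactSpace M] in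
/-- `Hₖ` of the punctured part of `Û` maps isomorphically onto `Hₖ` of the punctured cone
neighbourhood (a homeomorphism). [folklore] -/
theorem isIso_map_subsetRestrict_val (k : ℕ) :
    IsIso (singularHomology.map ℤ ℤ (subsetRestrict (subsetIncl (c₀.collarConeNhd κ)) (c₀.mapsTo_val_punct_punctCone (κ := κ))) k) := by
  have hsub : c₀.punctCone κ ⊆ range (Subtype.val : ↥(c₀.collarConeNhd κ) → ClosedModel (m + 1) c₀.W) := by
    rintro y ⟨hy, -⟩
    exact ⟨⟨y, hy⟩, rfl⟩
  have heq : (Subtype.val ⁻¹' c₀.punct : Set ↥(c₀.collarConeNhd κ)) = Subtype.val ⁻¹' c₀.punctCone κ := by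
    ext u
    exact ⟨fun hu => ⟨u.2, hu⟩, fun hu => hu.2⟩
  let e : ↥(Subtype.val ⁻¹' c₀.punct : Set ↥(c₀.collarConeNhd κ)) ≃ₜ ↥(c₀.punctCone κ) :=
    (Homeomorph.setCongr heq).trans (IsEmbedding.subtypeVal.homeomorphOfSubsetRange hsub)
  exact singularHomology.isIso_map_of_homeomorph ℤ ℤ e _ (fun u => Subtype.ext rfl) k

omit [IsManifold (𝓡 (m + 1)) ∞ M] [CompactSpace M] in
/-- **`∂z` generates `Hₘ₊₁(∂W; ℤ)`** for a relative fundamental class `z`: `∂z` is the fundamental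
class of the boundary orientation of the closed connected manifold `∂W ≅ M` (Spanier Cor. 6.3.10,
Hatcher Thm. 3.26(a)). [cite: HatcherAT2002, §3.3 Thm. 3.26] -/
theorem isGenerator_δ_of_isRelFundamentalClass [ConnectedSpace M]
    {z : relativeSingularHomology ℤ ℤ c₀.W ((𝓡∂ (m + 1 + 1)).boundary c₀.W) (m + 1 + 1)}
    (hz : IsRelFundamentalClass ℤ ((𝓡∂ (m + 1 + 1)).boundary c₀.W) z) :
    ∃ e : singularHomology ℤ ℤ ↥((𝓡∂ (m + 1 + 1)).boundary c₀.W) (m + 1) ≃ₗ[ℤ] ℤ,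
      e (relativeSingularHomology.δ ℤ ℤ c₀.W ((𝓡∂ (m + 1 + 1)).boundary c₀.W) (m + 1) z) = 1 := by
  haveI : CompactSpace ↥((𝓡∂ (m + 1 + 1)).boundary c₀.W) :=
    isCompact_iff_compactSpace.1 isCompact_boundary
  haveI : ConnectedSpace ↥((𝓡∂ (m + 1 + 1)).boundary c₀.W) :=
    isConnected_iff_connectedSpace.1 (c₀.range_incl ▸ isConnected_range c₀.continuous_incl)
  have hn : m + 1 ≠ 0 := Nat.succ_ne_zero m
  set μB := boundaryOrientation ℤ hn hz with hμB
  obtain ⟨x₀⟩ := (inferInstance : Nonempty ↥((𝓡∂ (m + 1 + 1)).boundary c₀.W))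
  haveI := singularHomology.isIso_toLocal_of_orientation μB x₀
  refine (exists_linearEquiv_apply_eq_one_iff_of_isIso (singularHomology.toLocal ℤ ℤ x₀ (m + 1)) _).1 ?_
  exact μB.isGenerator x₀

omit [IsManifold (𝓡 (m + 1)) ∞ M] in
/-- **Mayer–Vietoris at the cone point: `ĉ|_∞` generates `Hₘ₊₂(Ŵ | ∞; ℤ)`.** See the module
docstring for the argument. [cite: KervaireMilnorAnnals1963, §7, footnote pp. 528–529] [cite: HatcherAT2002, §2.2 (Mayer–Vietoris) and Prop. 2.22] -/
theorem isGenerator_toLocal_capClass_infty [ConnectedSpace M] (hκ : ∀ x : M, κ.collar (x, 0) = c₀.incl x)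
    {z : relativeSingularHomology ℤ ℤ c₀.W ((𝓡∂ (m + 1 + 1)).boundary c₀.W) (m + 1 + 1)}
    (hz : IsRelFundamentalClass ℤ ((𝓡∂ (m + 1 + 1)).boundary c₀.W) z) :
    ∃ e : localHomology ℤ ℤ (ClosedModel (m + 1) c₀.W) ClosedModel.infty (m + 1 + 1) ≃ₗ[ℤ] ℤ,
      e (singularHomology.toLocal ℤ ℤ ClosedModel.infty (m + 1 + 1) (c₀.capClass z)) = 1 := by
  have hBU : ((𝓡∂ (m + 1 + 1)).boundary c₀.W) ⊆ (κ.below 1) := c₀.boundary_subset_below hκ zero_lt_one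
  have hAP : (c₀.punctCone κ) ⊆ c₀.punct := inter_subset_right
  have hAU : (c₀.punctCone κ) ⊆ (c₀.collarConeNhd κ) := inter_subset_left
  have hinf : ClosedModel.infty ∈ (c₀.collarConeNhd κ) := c₀.infty_mem_collarConeNhd hκ
  -- the W-side class
  set zU := relativeSingularHomology.map ℤ ℤ (ContinuousMap.id c₀.W) (mapsTo_id_of_subset hBU) (m + 1 + 1) z with hzU
  haveI hE3 := c₀.isIso_map_valICM_strip hκ (m + 1 + 1)
  set E3 := relativeSingularHomology.map ℤ ℤ c₀.valICM (c₀.mapsTo_val_stripInterior κ) (m + 1 + 1) with hE3def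
  set yO := inv E3 zU with hyO
  have hE3y : E3 yO = zU := by rw [hyO, ← ModuleCat.comp_apply, IsIso.inv_hom_id, ModuleCat.id_apply]
  set a := relativeSingularHomology.map ℤ ℤ c₀.coeCM (c₀.mapsTo_coeCM_strip_punctCone hκ) (m + 1 + 1) yO with ha
  -- the cone-side class
  haveI hE1 := c₀.isIso_map_collarConeNhd_punct hκ (m + 1 + 1)
  set E1 := relativeSingularHomology.map ℤ ℤ (subsetIncl (c₀.collarConeNhd κ)) (mapsTo_preimage Subtype.val c₀.punct) (m + 1 + 1) with hE1def
  set w₀ := inv E1 (singularHomology.toLocal ℤ ℤ ClosedModel.infty (m + 1 + 1) (c₀.capClass z)) with hw₀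
  have hE1w : E1 w₀ = singularHomology.toLocal ℤ ℤ ClosedModel.infty (m + 1 + 1) (c₀.capClass z) := by
    rw [hw₀, ← ModuleCat.comp_apply, IsIso.inv_hom_id, ModuleCat.id_apply]
  set b := relativeSingularHomology.map ℤ ℤ (subsetIncl (c₀.collarConeNhd κ)) (c₀.mapsTo_val_punct_punctCone (κ := κ)) (m + 1 + 1) w₀ with hb
  -- `j_A (c₀.capClass z)`
  set jA := relativeSingularHomology.ofAbsolute ℤ ℤ (ClosedModel (m + 1) c₀.W) (c₀.punctCone κ) (m + 1 + 1) (c₀.capClass z) with hjA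
  -- the two restrictions of `j_A (c₀.capClass z) - a - b` vanish
  have hPmap : relativeSingularHomology.map ℤ ℤ (ContinuousMap.id (ClosedModel (m + 1) c₀.W)) (mapsTo_id_of_subset hAP) (m + 1 + 1)
      (jA - a - b) = 0 := by
    rw [map_sub, map_sub]
    -- `j_A (c₀.capClass z) ↦ (c₀.capClass z)|_∞`
    have h1 : relativeSingularHomology.map ℤ ℤ (ContinuousMap.id (ClosedModel (m + 1) c₀.W)) (mapsTo_id_of_subset hAP) (m + 1 + 1) jA =
        singularHomology.toLocal ℤ ℤ ClosedModel.infty (m + 1 + 1) (c₀.capClass z) := by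
      rw [hjA, ← ModuleCat.comp_apply, relativeSingularHomology.ofAbsolute_comp_map, singularHomology.map_id,
        Category.id_comp]
      rfl
    -- `a ↦ 0` (it comes from `H(W ∖ ∂W, W ∖ ∂W) = 0`)
    have h2 : relativeSingularHomology.map ℤ ℤ (ContinuousMap.id (ClosedModel (m + 1) c₀.W)) (mapsTo_id_of_subset hAP) (m + 1 + 1) a = 0 := by
      have hOP : MapsTo (c₀.coeCM : ManifoldInterior (m + 1) c₀.W → (ClosedModel (m + 1) c₀.W)) univ c₀.punct := fun v _ => OnePoint.coe_ne_infty v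
      have hfac : relativeSingularHomology.map ℤ ℤ c₀.coeCM (c₀.mapsTo_coeCM_strip_punctCone hκ) (m + 1 + 1) ≫
          relativeSingularHomology.map ℤ ℤ (ContinuousMap.id (ClosedModel (m + 1) c₀.W)) (mapsTo_id_of_subset hAP) (m + 1 + 1) =
          relativeSingularHomology.map ℤ ℤ (ContinuousMap.id _) (mapsTo_id_of_subset (subset_univ _)) (m + 1 + 1) ≫
            relativeSingularHomology.map ℤ ℤ c₀.coeCM hOP (m + 1 + 1) := by
        rw [← relativeSingularHomology.map_comp, ← relativeSingularHomology.map_comp]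
        rfl
      rw [ha, ← ModuleCat.comp_apply, hfac, ModuleCat.comp_apply,
        eq_zero_of_isZero' ℤ (isZero_relativeSingularHomology_univ ℤ ℤ (m + 1 + 1)) (relativeSingularHomology.map ℤ ℤ
          (ContinuousMap.id _) (mapsTo_id_of_subset (subset_univ _)) (m + 1 + 1) yO), map_zero]
    -- `b ↦ E1 w₀ = (c₀.capClass z)|_∞`
    have h3 : relativeSingularHomology.map ℤ ℤ (ContinuousMap.id (ClosedModel (m + 1) c₀.W)) (mapsTo_id_of_subset hAP) (m + 1 + 1) b =
        singularHomology.toLocal ℤ ℤ ClosedModel.infty (m + 1 + 1) (c₀.capClass z) := by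
      have hfac : relativeSingularHomology.map ℤ ℤ (subsetIncl (c₀.collarConeNhd κ)) (c₀.mapsTo_val_punct_punctCone (κ := κ)) (m + 1 + 1) ≫
          relativeSingularHomology.map ℤ ℤ (ContinuousMap.id (ClosedModel (m + 1) c₀.W)) (mapsTo_id_of_subset hAP) (m + 1 + 1) = E1 := by
        rw [hE1def, ← relativeSingularHomology.map_comp]
        rfl
      rw [hb, ← ModuleCat.comp_apply, hfac, hE1w]
    rw [h1, h2, h3, sub_zero, sub_self]
  have hUmap : relativeSingularHomology.map ℤ ℤ (ContinuousMap.id (ClosedModel (m + 1) c₀.W)) (mapsTo_id_of_subset hAU) (m + 1 + 1)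
      (jA - a - b) = 0 := by
    rw [map_sub, map_sub]
    have hBUh : MapsTo (boundaryCollapse (m + 1) c₀.W) ((𝓡∂ (m + 1 + 1)).boundary c₀.W) (c₀.collarConeNhd κ) :=
      (mapsTo_boundaryCollapse (m + 1) c₀.W).mono_right (singleton_subset_iff.2 hinf)
    -- `j_A (c₀.capClass z) ↦ q⁎ z` read in `(Ŵ, Û)`
    have h1 : relativeSingularHomology.map ℤ ℤ (ContinuousMap.id (ClosedModel (m + 1) c₀.W)) (mapsTo_id_of_subset hAU) (m + 1 + 1) jA =
        relativeSingularHomology.map ℤ ℤ (boundaryCollapse (m + 1) c₀.W) hBUh (m + 1 + 1) z := by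
      rw [hjA, ← ModuleCat.comp_apply, relativeSingularHomology.ofAbsolute_comp_map, singularHomology.map_id,
        Category.id_comp]
      exact c₀.ofAbsolute_capClass_of_mem z hinf
    -- `a ↦ q⁎ z` too (`coe = q ∘ val` and `val⁎ yO = zU`)
    have h2 : relativeSingularHomology.map ℤ ℤ (ContinuousMap.id (ClosedModel (m + 1) c₀.W)) (mapsTo_id_of_subset hAU) (m + 1 + 1) a =
        relativeSingularHomology.map ℤ ℤ (boundaryCollapse (m + 1) c₀.W) hBUh (m + 1 + 1) z := by
      have hfac : relativeSingularHomology.map ℤ ℤ c₀.coeCM (c₀.mapsTo_coeCM_strip_punctCone hκ) (m + 1 + 1) ≫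
          relativeSingularHomology.map ℤ ℤ (ContinuousMap.id (ClosedModel (m + 1) c₀.W)) (mapsTo_id_of_subset hAU) (m + 1 + 1) =
          E3 ≫ relativeSingularHomology.map ℤ ℤ (boundaryCollapse (m + 1) c₀.W)
            (c₀.mapsTo_boundaryCollapse_below_collarConeNhd hκ) (m + 1 + 1) := by
        rw [hE3def, ← relativeSingularHomology.map_comp, ← relativeSingularHomology.map_comp]
        exact relativeSingularHomology.map_congr ℤ ℤ c₀.boundaryCollapse_comp_valICM.symm _ _ (m + 1 + 1)
      have hfac2 : relativeSingularHomology.map ℤ ℤ (ContinuousMap.id c₀.W) (mapsTo_id_of_subset hBU) (m + 1 + 1) ≫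
          relativeSingularHomology.map ℤ ℤ (boundaryCollapse (m + 1) c₀.W)
            (c₀.mapsTo_boundaryCollapse_below_collarConeNhd hκ) (m + 1 + 1) =
          relativeSingularHomology.map ℤ ℤ (boundaryCollapse (m + 1) c₀.W) hBUh (m + 1 + 1) := by
        rw [← relativeSingularHomology.map_comp]
        rfl
      rw [ha, ← ModuleCat.comp_apply, hfac, ModuleCat.comp_apply, hE3y, hzU, ← ModuleCat.comp_apply, hfac2]
    -- `b ↦ 0` (through `H(Û, Û) = 0`)
    have h3 : relativeSingularHomology.map ℤ ℤ (ContinuousMap.id (ClosedModel (m + 1) c₀.W)) (mapsTo_id_of_subset hAU) (m + 1 + 1) b = 0 := by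
      have hUU : MapsTo (Subtype.val : ↥(c₀.collarConeNhd κ) → (ClosedModel (m + 1) c₀.W)) univ (c₀.collarConeNhd κ) := fun u _ => u.2
      have hfac : relativeSingularHomology.map ℤ ℤ (subsetIncl (c₀.collarConeNhd κ)) (c₀.mapsTo_val_punct_punctCone (κ := κ)) (m + 1 + 1) ≫
          relativeSingularHomology.map ℤ ℤ (ContinuousMap.id (ClosedModel (m + 1) c₀.W)) (mapsTo_id_of_subset hAU) (m + 1 + 1) =
          relativeSingularHomology.map ℤ ℤ (ContinuousMap.id _) (mapsTo_id_of_subset (subset_univ _)) (m + 1 + 1) ≫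
            relativeSingularHomology.map ℤ ℤ (subsetIncl (c₀.collarConeNhd κ)) hUU (m + 1 + 1) := by
        rw [← relativeSingularHomology.map_comp, ← relativeSingularHomology.map_comp]
        rfl
      rw [hb, ← ModuleCat.comp_apply, hfac, ModuleCat.comp_apply,
        eq_zero_of_isZero' ℤ (isZero_relativeSingularHomology_univ ℤ ℤ (m + 1 + 1)) (relativeSingularHomology.map ℤ ℤ
          (ContinuousMap.id _) (mapsTo_id_of_subset (subset_univ _)) (m + 1 + 1) w₀), map_zero]
    rw [h1, h2, h3, sub_self, sub_zero]
  -- hence `j_A (c₀.capClass z) = a + b`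
  have hsum : jA - a - b = 0 :=
    relativeSingularHomology.eq_zero_of_map_eq_zero_of_cover ℤ ℤ
      (c₀.interior_compl_infty_union_interior_collarConeNhd hκ ▸ by rw [union_comm]) (m + 1 + 1) (jA - a - b) hPmap hUmap
  -- apply `∂ : H(Ŵ, (c₀.punctCone κ)) → H((c₀.punctCone κ))`: `∂ b = -∂ a`
  have hδ : relativeSingularHomology.δ ℤ ℤ (ClosedModel (m + 1) c₀.W) (c₀.punctCone κ) (m + 1) b = -relativeSingularHomology.δ ℤ ℤ (ClosedModel (m + 1) c₀.W) (c₀.punctCone κ) (m + 1) a := by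
    have h0 : relativeSingularHomology.δ ℤ ℤ (ClosedModel (m + 1) c₀.W) (c₀.punctCone κ) (m + 1) jA = 0 := by
      rw [hjA, ← ModuleCat.comp_apply, relativeSingularHomology.ofAbsolute_comp_δ]
      rfl
    have : jA = a + b := by
      have h := hsum
      rw [sub_sub, sub_eq_zero] at h
      exact h
    rw [this, map_add] at h0
    exact eq_neg_of_add_eq_zero_right h0
  -- `∂ a` is a generator of `Hₘ₊₁((c₀.punctCone κ))`
  have hgen_a : ∃ e : singularHomology ℤ ℤ ↥(c₀.punctCone κ) (m + 1) ≃ₗ[ℤ] ℤ,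
      e (relativeSingularHomology.δ ℤ ℤ (ClosedModel (m + 1) c₀.W) (c₀.punctCone κ) (m + 1) a) = 1 := by
    -- `∂ a = ρ_a (∂ yO)`
    have hna : relativeSingularHomology.δ ℤ ℤ (ClosedModel (m + 1) c₀.W) (c₀.punctCone κ) (m + 1) a =
        singularHomology.map ℤ ℤ (subsetRestrict c₀.coeCM (c₀.mapsTo_coeCM_strip_punctCone hκ)) (m + 1)
          (relativeSingularHomology.δ ℤ ℤ _ (c₀.stripInterior κ) (m + 1) yO) := by
      rw [ha, relativeSingularHomology.δ_map_apply]
    rw [hna]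
    haveI := c₀.isIso_map_subsetRestrict_coeCM hκ (m + 1)
    refine (exists_linearEquiv_apply_eq_one_iff_of_isIso _ _).2 ?_
    -- `σ⁎ (∂ yO) = ∂ zU = i⁎ (∂ z)`, `σ⁎` and `i⁎` isomorphisms, `∂ z` a generator
    have hσ : singularHomology.map ℤ ℤ (c₀.stripIncl κ) (m + 1)
        (relativeSingularHomology.δ ℤ ℤ _ (c₀.stripInterior κ) (m + 1) yO) =
        relativeSingularHomology.δ ℤ ℤ c₀.W (κ.below 1) (m + 1) zU := by
      rw [← hE3y, hE3def, relativeSingularHomology.δ_map_apply]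
    have hi : relativeSingularHomology.δ ℤ ℤ c₀.W (κ.below 1) (m + 1) zU =
        singularHomology.map ℤ ℤ (subsetInclusion hBU) (m + 1)
          (relativeSingularHomology.δ ℤ ℤ c₀.W ((𝓡∂ (m + 1 + 1)).boundary c₀.W) (m + 1) z) := by
      rw [hzU, relativeSingularHomology.δ_map_apply]
      rfl
    haveI := c₀.isIso_map_stripIncl hκ (m + 1)
    haveI := c₀.isIso_map_inclusion_boundary_below hκ zero_lt_one (m + 1)
    refine (exists_linearEquiv_apply_eq_one_iff_of_isIso (singularHomology.map ℤ ℤ (c₀.stripIncl κ) (m + 1)) _).1 ?_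
    rw [hσ, hi]
    exact (exists_linearEquiv_apply_eq_one_iff_of_isIso _ _).2 (c₀.isGenerator_δ_of_isRelFundamentalClass hz)
  -- hence `∂ b`, `∂ w₀`, `w₀` and `(c₀.capClass z)|_∞ = E1 w₀` are generators
  have hgen_b : ∃ e : singularHomology ℤ ℤ ↥(c₀.punctCone κ) (m + 1) ≃ₗ[ℤ] ℤ,
      e (relativeSingularHomology.δ ℤ ℤ (ClosedModel (m + 1) c₀.W) (c₀.punctCone κ) (m + 1) b) = 1 := by
    rw [hδ]
    exact exists_linearEquiv_apply_eq_one_neg hgen_a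
  have hnb : relativeSingularHomology.δ ℤ ℤ (ClosedModel (m + 1) c₀.W) (c₀.punctCone κ) (m + 1) b =
      singularHomology.map ℤ ℤ (subsetRestrict (subsetIncl (c₀.collarConeNhd κ)) (c₀.mapsTo_val_punct_punctCone (κ := κ))) (m + 1)
        (relativeSingularHomology.δ ℤ ℤ ↥(c₀.collarConeNhd κ) (Subtype.val ⁻¹' c₀.punct) (m + 1) w₀) := by
    rw [hb, relativeSingularHomology.δ_map_apply]
  rw [hnb] at hgen_b
  haveI := c₀.isIso_map_subsetRestrict_val (κ := κ) (m + 1)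
  have hgen_δw : ∃ e : singularHomology ℤ ℤ ↥(Subtype.val ⁻¹' c₀.punct : Set ↥(c₀.collarConeNhd κ)) (m + 1) ≃ₗ[ℤ] ℤ,
      e (relativeSingularHomology.δ ℤ ℤ ↥(c₀.collarConeNhd κ) (Subtype.val ⁻¹' c₀.punct) (m + 1) w₀) = 1 :=
    (exists_linearEquiv_apply_eq_one_iff_of_isIso _ _).1 hgen_b
  haveI : ContractibleSpace ↥(c₀.collarConeNhd κ) := c₀.contractibleSpace_collarConeNhd hκ
  haveI := isIso_δ_of_contractibleSpace ℤ ℤ (X := ↥(c₀.collarConeNhd κ)) (Subtype.val ⁻¹' c₀.punct) (Nat.succ_ne_zero m)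
  have hgen_w : ∃ e : relativeSingularHomology ℤ ℤ ↥(c₀.collarConeNhd κ) (Subtype.val ⁻¹' c₀.punct) (m + 1 + 1) ≃ₗ[ℤ] ℤ, e w₀ = 1 :=
    (exists_linearEquiv_apply_eq_one_iff_of_isIso _ _).1 hgen_δw
  rw [← hE1w]
  exact (exists_linearEquiv_apply_eq_one_iff_of_isIso E1 _).2 hgen_w

end ConePoint

/-! #### The orientation and its fundamental class -/

section Orientation

/-- **The homological orientation of the closed model `Ŵ = W ∪ cone(∂W)` determined by a relative
fundamental class `z` of `(W, ∂W)`**: local classes `ĉ|ₓ` of the absolute class `ĉ` with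
`j⁎ ĉ = q⁎ z` (Kervaire–Milnor 1963, footnote pp. 528–529: the cone `M ∪ cone(bM)` is "a closed
homology manifold" oriented by `M`). [cite: KervaireMilnorAnnals1963, §7, footnote pp. 528–529] -/
def coneOrientation [ConnectedSpace M] {z : relativeSingularHomology ℤ ℤ c₀.W ((𝓡∂ (m + 1 + 1)).boundary c₀.W) (m + 1 + 1)}
    (hz : IsRelFundamentalClass ℤ ((𝓡∂ (m + 1 + 1)).boundary c₀.W) z) :
    HomologicalOrientation ℤ (ClosedModel (m + 1) c₀.W) (m + 1 + 1) :=
  HomologicalOrientation.ofGeneratingClass (c₀.capClass z) fun x => by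
    induction x using OnePoint.rec with
    | infty =>
      obtain ⟨κ, hκ⟩ := c₀.exists_boundaryCollar
      exact c₀.isGenerator_toLocal_capClass_infty hκ hz
    | coe v => exact c₀.isGenerator_toLocal_capClass_coe hz v

omit [IsManifold (𝓡 (m + 1)) ∞ M] [CompactSpace M] in
/-- The interior `W ∖ ∂W` of a null-cobordism of a nonempty `M` with connected `W` is not compact.
[folklore] -/
theorem noncompactSpace_interior [Nonempty M] [ConnectedSpace c₀.W] : NoncompactSpace c₀.Interior := by
  refine not_compactSpace_iff.1 fun hc => ?_
  have hrange : range (InteriorManifold.val : c₀.Interior → c₀.W) = (𝓡∂ (m + 1 + 1)).interior c₀.W :=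
    InteriorManifold.range_val
  have hcomp : IsCompact ((𝓡∂ (m + 1 + 1)).interior c₀.W) := by
    rw [← hrange]
    exact isCompact_range InteriorManifold.continuous_val
  have hclopen : IsClopen ((𝓡∂ (m + 1 + 1)).interior c₀.W) :=
    ⟨hcomp.isClosed, (𝓡∂ (m + 1 + 1)).isOpen_interior one_ne_zero⟩
  obtain ⟨x⟩ := ‹Nonempty M›
  haveI : Nonempty c₀.W := ⟨c₀.incl x⟩
  rcases isClopen_iff.1 hclopen with h | h
  · have hne : ((𝓡∂ (m + 1 + 1)).interior c₀.W).Nonempty := interior_nonempty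
    exact absurd h hne.ne_empty
  · have hb : c₀.incl x ∈ (𝓡∂ (m + 1 + 1)).boundary c₀.W := c₀.incl_mem_boundary x
    rw [← ModelWithCorners.compl_interior, h, compl_univ] at hb
    exact hb

omit [IsManifold (𝓡 (m + 1)) ∞ M] [CompactSpace M] in
/-- **`Hₘ₊₂(Ŵ ∖ ∞; ℤ) = 0`**: the punctured closed model is the interior `W ∖ ∂W`, a connected
non-compact `(m+2)`-manifold (Hatcher 2002, Prop. 3.29). [cite: HatcherAT2002, Prop. 3.29] -/
theorem isZero_singularHomology_punct [Nonempty M] [ConnectedSpace c₀.W] :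
    IsZero (singularHomology ℤ ℤ ↥(c₀.punct) (m + 1 + 1)) := by
  haveI := c₀.noncompactSpace_interior
  have h0 : IsZero (singularHomology ℤ ℤ c₀.Interior (m + 1 + 1)) :=
    isZero_singularHomology_of_noncompactSpace_holds ℤ c₀.Interior (m + 1 + 1) le_rfl
  have hrange : range (InteriorManifold.val : c₀.Interior → c₀.W) = (𝓡∂ (m + 1 + 1)).interior c₀.W :=
    InteriorManifold.range_val
  -- `Interior ≃ₜ W ∖ ∂W ≃ₜ range coe = Ŵ ∖ ∞`
  let e₁ : c₀.Interior ≃ₜ ManifoldInterior (m + 1) c₀.W :=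
    (InteriorManifold.isEmbedding_val : IsEmbedding (InteriorManifold.val : c₀.Interior → c₀.W)).toHomeomorph.trans
      (Homeomorph.setCongr hrange)
  let e₂ : ManifoldInterior (m + 1) c₀.W ≃ₜ ↥(c₀.punct) :=
    (OnePoint.isOpenEmbedding_coe.toIsEmbedding.toHomeomorph).trans
      (Homeomorph.setCongr (OnePoint.compl_infty (X := ManifoldInterior (m + 1) c₀.W)).symm)
  exact h0.of_iso (singularHomology.mapIso ℤ ℤ (e₁.trans e₂) (m + 1 + 1)).symm

omit [IsManifold (𝓡 (m + 1)) ∞ M] [CompactSpace M] in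
/-- **Uniqueness at the cone point**: two classes of `Hₘ₊₂(Ŵ)` with the same local image at `∞` are
equal (their difference comes from `Hₘ₊₂(Ŵ ∖ ∞) = 0`). [cite: HatcherAT2002, Lemma 3.27, with Prop. 3.29] -/
theorem eq_of_toLocal_infty_eq [Nonempty M] [ConnectedSpace c₀.W]
    {c c' : singularHomology ℤ ℤ (ClosedModel (m + 1) c₀.W) (m + 1 + 1)}
    (h : singularHomology.toLocal ℤ ℤ ClosedModel.infty (m + 1 + 1) c =
      singularHomology.toLocal ℤ ℤ ClosedModel.infty (m + 1 + 1) c') : c = c' := by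
  rw [← sub_eq_zero]
  have h0 : relativeSingularHomology.ofAbsolute ℤ ℤ (ClosedModel (m + 1) c₀.W) c₀.punct (m + 1 + 1) (c - c') = 0 := by
    rw [map_sub]
    exact sub_eq_zero.2 h
  obtain ⟨η, hη⟩ := (ShortComplex.moduleCat_exact_iff _).1
    (relativeSingularHomology.exact_map_ofAbsolute ℤ ℤ (c₀.punct) (m + 1 + 1)) (c - c') h0
  rw [← hη, eq_zero_of_isZero' ℤ c₀.isZero_singularHomology_punct η, map_zero]

/-- **The fundamental class of the cone orientation is `ĉ`.** [cite: HatcherAT2002, §3.3 Thm. 3.26] -/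
theorem fundamentalClass_coneOrientation [ConnectedSpace M] [ConnectedSpace c₀.W]
    {z : relativeSingularHomology ℤ ℤ c₀.W ((𝓡∂ (m + 1 + 1)).boundary c₀.W) (m + 1 + 1)}
    (hz : IsRelFundamentalClass ℤ ((𝓡∂ (m + 1 + 1)).boundary c₀.W) z) :
    (c₀.coneOrientation hz).fundamentalClass = c₀.capClass z := by
  have hex : ∃ c, IsFundamentalClass (c₀.coneOrientation hz) c :=
    ⟨c₀.capClass z, HomologicalOrientation.isFundamentalClass_ofGeneratingClass _ _⟩
  have hf := HomologicalOrientation.isFundamentalClass_fundamentalClass_of_exists hex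
  exact c₀.eq_of_toLocal_infty_eq (hf ClosedModel.infty)

/-- **The closed model of an oriented null-cobordism is oriented compatibly with `[W, ∂W]`**
(Kervaire–Milnor 1963, footnote pp. 528–529; Hatcher 2002, Prop. 2.22): for a null-cobordism
`M = ∂W` with `M` closed connected nonempty, `W` connected, and a relative fundamental class
`z ∈ Hₘ₊₂(W, ∂W; ℤ)`, there is a homological `ℤ`-orientation `μ'` of `Ŵ = W ∪ cone(∂W)` with
`q⁎ z = j⁎ [Ŵ]_{μ'}` in `Hₘ₊₂(Ŵ, ∞; ℤ)` — clause (ii) of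
`Literature.Topology.FourManifolds.IsOrientedBoundary`. [cite: KervaireMilnorAnnals1963, §7, footnote pp. 528–529] [cite: HatcherAT2002, Prop. 2.22 and §3.3 p. 253] -/
theorem exists_orientation_closedModel_of_isRelFundamentalClass [ConnectedSpace M] [ConnectedSpace c₀.W]
    {z : relativeSingularHomology ℤ ℤ c₀.W ((𝓡∂ (m + 1 + 1)).boundary c₀.W) (m + 1 + 1)}
    (hz : IsRelFundamentalClass ℤ ((𝓡∂ (m + 1 + 1)).boundary c₀.W) z) :
    ∃ μ' : HomologicalOrientation ℤ (ClosedModel (m + 1) c₀.W) (m + 1 + 1),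
      relativeSingularHomology.map ℤ ℤ (boundaryCollapse (m + 1) c₀.W) (mapsTo_boundaryCollapse (m + 1) c₀.W)
          (m + 1 + 1) z =
        relativeSingularHomology.ofAbsolute ℤ ℤ (ClosedModel (m + 1) c₀.W) {ClosedModel.infty} (m + 1 + 1)
          μ'.fundamentalClass :=
  ⟨c₀.coneOrientation hz, by rw [c₀.fundamentalClass_coneOrientation hz, c₀.ofAbsolute_capClass]⟩

end Orientation

end NullCobordism

end Literature.Topology.FourManifolds

end
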